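import Literature.NumberTheory.Automorphic.SelfDualStableLatticeDepthCount            -- ★ A-p13 FILE 2: transport, monotonicity, finiteness, modular level counts
import Literature.NumberTheory.Automorphic.UnitaryGroupSelfDualLocus                 -- ★ L1: `exists_mem_unitaryGroupOfForm_mul_of_selfDual` (Jacobowitz transitivity)
import HarnessLib

/-!
# DEPTH COUNTS, FRAMES: finiteness along a change of frame, unitary frames of a stable self-dual lattice, and the ϖ-modular
# finiteness and exact-depth count (Flicker 1998 §6 p. 95; Kottwitz 1988 §2; Kottwitz 1992 §7)

Topic `NumberTheory/Automorphic`; namespace `Literature.NumberTheory.Automorphic`.  THEOREMS ONLY (no definition, no instance, no notation, no named fact,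
no `sorry`).  Cell `pub/hodgecm-mathlib`, F0∕P3a road «R1LL-tree» (LEAD F0P3a-plan (g10) WORD T9-8 (A); architect A-p16 (g27) RULINGS A-4 (a)(c), A-6 (c)),
hand A-p13 (g31); third file of the I-2 «depth counts» brick after ★ `SelfDualStableLatticeLevelBallCount` (FILE 1) and ★ `SelfDualStableLatticeDepthCount`
(FILE 2).  HC_CM is proved only modulo the printed citations until rung 0 closes; nothing printed is a letter here.

* §1 `finite_selfDualStable_of_congr` — `S(ᵗσ(P)JP, P⁻¹γP)` finite ⇒ `S(J, γ)` finite (`Λ ↦ P⁻¹Λ` is injective with that image, ★ (L5-d1)).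
* (§2, the coset ↔ lattice dictionary restricted to a lattice predicate, is ★ F0P2-p01 (g10) `FixedCosetsStableLatticesSep` ::
  `ncard_sep_fixedBy_unitary_eq_ncard`, landed one minute before this file — not restated here.)
* §2 `exists_unitary_frame_of_mem_selfDualStable` — `Λ ∈ S(J, γ)`, `γ ∈ U(J)`, `J ∈ GL_n(𝒪)` hermitian (Jacobowitz hypotheses) ⇒ `Λ = Λ(u)` with `u ∈ U(J)` and
  `u⁻¹γu ∈ U(J) ⊓ GL_n(𝒪)` (the matrix `k` of B-p12 (g29)'s LEMMA U; its depth token is FILE 2 `map_sub_smul_one_le_iff_forall_mem` at `g := u`).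
* §3 `finite_modularStable_smul_one_diag` · **`ncard_modularStable_smul_one_diag_depth_eq_ite`** (`#{Λ ∈ M(ϖ^e•1, γ) | depth exactly i} =
  [i ≤ N ∧ (N − i) % 2 = 1 − e]·w(N − i)` — the type-`1−e` sphere term).

## References
* [Flicker1998UnitaryFL] Y. Z. Flicker, *Elementary proof of the fundamental lemma for a unitary group*, Canad. J. Math. 50 (1998), §6 p. 95 + REMARK.
* [Kottwitz1988] R. E. Kottwitz, *Tamagawa numbers*, Ann. of Math. 127 (1988), §2.
* [Kottwitz1992] R. E. Kottwitz, *Points on some Shimura varieties over finite fields*, JAMS 5 (1992), §7 Lemma 7.2, Cor. 7.3.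
* [Jacobowitz1962] R. Jacobowitz, *Hermitian forms over local fields*, Amer. J. Math. 84 (1962), §7 Thm. 7.1.
* [Macdonald1995] I. G. Macdonald, *Symmetric functions and Hall polynomials* (1995), Ch. V §2.
-/

set_option autoImplicit false

noncomputable section

open scoped ValuativeRel Matrix MatrixGroups
open Matrix ValuativeRel

namespace Literature.NumberTheory.Automorphic

/-! ## §1 Finiteness along a change of frame -/

section FiniteCongr

variable {F : Type*} [Field F] [ValuativeRel F] (σ : F →+* F) {n : ℕ}

/-- **`S(ᵗσ(P) J P, P⁻¹γP)` finite ⇒ `S(J, γ)` finite**: the former is the image of the latter under the injective map `Λ ↦ P⁻¹Λ`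
(★ (L5-d1) `image_map_inv_selfDualStable_eq`). [cite: Kottwitz1988, §2] [cite: Macdonald1995, Ch. V §2] -/
theorem finite_selfDualStable_of_congr (J : Matrix (Fin n) (Fin n) F) (γ P : GL (Fin n) F)
    (h : {Λ : Submodule 𝒪[F] (Fin n → F) |
        (∃ g : GL (Fin n) F, (∃ J' ∈ glInt n F, (J' : Matrix (Fin n) (Fin n) F) = formCongr σ g (formCongr σ P J)) ∧
            Λ = Submodule.span 𝒪[F] (Set.range ((g : Matrix (Fin n) (Fin n) F))ᵀ)) ∧
          Λ.map ((Matrix.toLin' (((P⁻¹ * γ * P : GL (Fin n) F)) : Matrix (Fin n) (Fin n) F)).restrictScalars 𝒪[F]) = Λ}.Finite) :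
    {Λ : Submodule 𝒪[F] (Fin n → F) |
        (∃ g : GL (Fin n) F, (∃ J' ∈ glInt n F, (J' : Matrix (Fin n) (Fin n) F) = formCongr σ g J) ∧
            Λ = Submodule.span 𝒪[F] (Set.range ((g : Matrix (Fin n) (Fin n) F))ᵀ)) ∧
          Λ.map ((Matrix.toLin' ((γ : GL (Fin n) F) : Matrix (Fin n) (Fin n) F)).restrictScalars 𝒪[F]) = Λ}.Finite := by
  have key : ∀ Λ : Submodule 𝒪[F] (Fin n → F),
      (Λ.map ((Matrix.toLin' ((P⁻¹ : GL (Fin n) F) : Matrix (Fin n) (Fin n) F)).restrictScalars 𝒪[F])).map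
        ((Matrix.toLin' ((P : GL (Fin n) F) : Matrix (Fin n) (Fin n) F)).restrictScalars 𝒪[F]) = Λ := by
    intro Λ
    have hcomp : ((Matrix.toLin' ((P : GL (Fin n) F) : Matrix (Fin n) (Fin n) F)).restrictScalars 𝒪[F]).comp
        ((Matrix.toLin' ((P⁻¹ : GL (Fin n) F) : Matrix (Fin n) (Fin n) F)).restrictScalars 𝒪[F]) = LinearMap.id := by
      apply LinearMap.ext
      intro x
      simp only [LinearMap.comp_apply, LinearMap.restrictScalars_apply, Matrix.toLin'_apply, LinearMap.id_apply, Matrix.mulVec_mulVec,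
        ← Units.val_mul, mul_inv_cancel, Units.val_one, Matrix.one_mulVec]
    rw [← Submodule.map_comp, hcomp, Submodule.map_id]
  have hinj : Function.Injective fun Λ : Submodule 𝒪[F] (Fin n → F) =>
      Λ.map ((Matrix.toLin' ((P⁻¹ : GL (Fin n) F) : Matrix (Fin n) (Fin n) F)).restrictScalars 𝒪[F]) := by
    intro Λ₁ Λ₂ hΛ
    have h' := congrArg (fun Λ : Submodule 𝒪[F] (Fin n → F) =>
      Λ.map ((Matrix.toLin' ((P : GL (Fin n) F) : Matrix (Fin n) (Fin n) F)).restrictScalars 𝒪[F])) hΛ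
    simp only [key] at h'
    exact h'
  refine Set.Finite.of_finite_image ?_ hinj.injOn
  rw [image_map_inv_selfDualStable_eq σ J γ P]
  exact h

end FiniteCongr

/-! ## §2 Unitary frames of a stable self-dual lattice -/

section Frame

variable {E : Type*} [Field E] [ValuativeRel E] {n : ℕ} (σ : E →+* E)

/-- **A `γ`-stable `J`-self-dual lattice is `Λ(u)` with `u ∈ U(J)` and `u⁻¹γu ∈ U(J) ∩ GL_n(𝒪)`** (`J ∈ GL_n(𝒪)` `σ`-hermitian, `γ ∈ U(J)`, Jacobowitz's
(trace)∕(norm) hypotheses): ★ `exists_mem_unitaryGroupOfForm_mul_of_selfDual` gives `g = u k`, `k ∈ GL_n(𝒪)`, so `Λ(g) = Λ(u)` (★ `span_range_transpose_eq_iff`),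
and `γΛ(u) = Λ(u)` is `u⁻¹γu ∈ GL_n(𝒪)` (★ `map_span_range_transpose_eq_self_iff`).  The matrix `k := u⁻¹γu` is B-p12 (g29)'s LEMMA U input (`J`-unitary, integral);
its depth token is ★ FILE 2 `map_sub_smul_one_le_iff_forall_mem` at `g := u`. [cite: Jacobowitz1962, §7 Thm. 7.1] [cite: Kottwitz1992, §7 Lemma 7.2, Cor. 7.3] -/
theorem exists_unitary_frame_of_mem_selfDualStable (hσσ : ∀ x, σ (σ x) = x) (hσO : ∀ x : 𝒪[E], σ x ∈ 𝒪[E])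
    (htr : ∃ b : 𝒪[E], (b : E) + σ b = 1) (hnorm : ∀ u : 𝒪[E], IsUnit u → σ u = u → ∃ t : 𝒪[E], (t : E) * σ t = u)
    (J : GL (Fin n) E) (hJ : J ∈ glInt n E) (hJh : ((J : Matrix (Fin n) (Fin n) E).map σ)ᵀ = J)
    {γ : GL (Fin n) E} (hγ : γ ∈ unitaryGroupOfForm σ (J : Matrix (Fin n) (Fin n) E)) {Λ : Submodule 𝒪[E] (Fin n → E)}
    (hΛ : Λ ∈ {Λ : Submodule 𝒪[E] (Fin n → E) |
        (∃ g : GL (Fin n) E, (∃ J' ∈ glInt n E, (J' : Matrix (Fin n) (Fin n) E) = formCongr σ g (J : Matrix (Fin n) (Fin n) E)) ∧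
            Λ = Submodule.span 𝒪[E] (Set.range ((g : Matrix (Fin n) (Fin n) E))ᵀ)) ∧
          Λ.map ((Matrix.toLin' ((γ : GL (Fin n) E) : Matrix (Fin n) (Fin n) E)).restrictScalars 𝒪[E]) = Λ}) :
    ∃ u ∈ unitaryGroupOfForm σ (J : Matrix (Fin n) (Fin n) E),
      Λ = Submodule.span 𝒪[E] (Set.range ((u : Matrix (Fin n) (Fin n) E))ᵀ) ∧
        u⁻¹ * γ * u ∈ unitaryGroupOfForm σ (J : Matrix (Fin n) (Fin n) E) ⊓ glInt n E := by
  obtain ⟨⟨g, hsd, rfl⟩, hstab⟩ := hΛ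
  obtain ⟨u, hu, k, hk, rfl⟩ := UnitaryGroup.exists_mem_unitaryGroupOfForm_mul_of_selfDual σ hσσ hσO htr hnorm J hJ hJh g hsd
  have hspan : Submodule.span 𝒪[E] (Set.range (((u * k : GL (Fin n) E)) : Matrix (Fin n) (Fin n) E)ᵀ) =
      Submodule.span 𝒪[E] (Set.range ((u : Matrix (Fin n) (Fin n) E))ᵀ) := by
    rw [eq_comm, span_range_transpose_eq_iff, inv_mul_cancel_left]
    exact hk
  refine ⟨u, hu, hspan, Subgroup.mem_inf.2 ⟨mul_mem (mul_mem (inv_mem hu) hγ) hu, ?_⟩⟩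
  rw [hspan, map_span_range_transpose_eq_self_iff] at hstab
  exact hstab

end Frame

/-! ## §3 The ϖ-modular (type `1 − e`) vertices: finiteness and the exact-depth count -/

section Modular

variable {F : Type*} [Field F] [ValuativeRel F] (σ : F →+* F) {ϖ : F} (hϖ : IsUniformizingElement ϖ)
variable (σO : 𝒪[F] →+* 𝒪[F]) (hσO' : ∀ x : 𝒪[F], ((σO x : 𝒪[F]) : F) = σ x) (hσσ : ∀ x, σO (σO x) = x)
  (hσϖ : σ ϖ = ϖ) {e : ℕ} (he : e ≤ 1)
  {a c : F} {N : ℕ} (γ : GL (Fin 2) F) (hγ : (γ : Matrix (Fin 2) (Fin 2) F) = !![a, 0; 0, c])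
  (ha : valuation F a = 1) (hc : valuation F c = 1) (hN : valuation F (a - c) = valuation F (ϖ ^ N))

include hϖ hσO' hσσ hσϖ he hγ ha hc hN in
/-- **`M(ϖ^e • 1, γ)` IS FINITE**: `M(ϖ^e•1) = S(ϖ^{e−1}•1)` (★ A-p03); for `e = 1` this is ★ FILE 2 `finite_selfDualStable_smul_one_diag` at parity `0`, for `e = 0`
it is `S(ϖ⁻¹•1, γ)`, finite by §1 along the scalar frame `P = ϖ•1` (`ᵗσ(P)(ϖ⁻¹•1)P = ϖ•1`, `P⁻¹γP = γ`) and FILE 2 §4 at parity `1`. [cite: Kottwitz1988, §2] -/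
theorem finite_modularStable_smul_one_diag [IsDiscreteValuationRing 𝒪[F]] [Finite (IsLocalRing.ResidueField 𝒪[F])]
    [IsAdicComplete (IsLocalRing.maximalIdeal 𝒪[F]) 𝒪[F]] {a₀ : 𝒪[F]} (ha₀ : IsUnit (σO a₀ - a₀)) {q : ℕ}
    (hq : Nat.card (IsLocalRing.ResidueField 𝒪[F]) = q ^ 2) :
    {Λ : Submodule 𝒪[F] (Fin 2 → F) |
        (∃ g : GL (Fin 2) F, (∃ J' ∈ glInt 2 F, ϖ • (J' : Matrix (Fin 2) (Fin 2) F) = formCongr σ g ((ϖ ^ (e : ℤ)) • (1 : Matrix (Fin 2) (Fin 2) F))) ∧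
          Λ = Submodule.span 𝒪[F] (Set.range ((g : Matrix (Fin 2) (Fin 2) F))ᵀ)) ∧
        Λ.map ((Matrix.toLin' (γ : Matrix (Fin 2) (Fin 2) F)).restrictScalars 𝒪[F]) = Λ}.Finite := by
  have hϖ0 : ϖ ≠ 0 := hϖ.ne_zero
  rw [setOf_modularStable_eq_selfDualStable σ hϖ0]
  rcases Nat.le_one_iff_eq_zero_or_eq_one.1 he with rfl | rfl
  · -- `e = 0`: `S(ϖ⁻¹ • 1, γ)` along the scalar frame `ϖ • 1`
    set P : GL (Fin 2) F := ⟨ϖ • (1 : Matrix (Fin 2) (Fin 2) F), ϖ⁻¹ • (1 : Matrix (Fin 2) (Fin 2) F),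
      by rw [Matrix.smul_mul, Matrix.one_mul, smul_smul, mul_inv_cancel₀ hϖ0, one_smul],
      by rw [Matrix.smul_mul, Matrix.one_mul, smul_smul, inv_mul_cancel₀ hϖ0, one_smul]⟩ with hPdef
    have hP : (P : Matrix (Fin 2) (Fin 2) F) = ϖ • (1 : Matrix (Fin 2) (Fin 2) F) := rfl
    refine finite_selfDualStable_of_congr σ _ γ P ?_
    rw [formCongr_eq_mul_self_smul_of_coe_eq_smul_one σ hσϖ P hP, inv_mul_mul_eq_self_of_coe_eq_smul_one P hP,
      show (ϖ * ϖ) • (ϖ⁻¹ • ((ϖ ^ ((0 : ℕ) : ℤ)) • (1 : Matrix (Fin 2) (Fin 2) F))) = (ϖ ^ ((1 : ℕ) : ℤ)) • (1 : Matrix (Fin 2) (Fin 2) F) by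
        rw [smul_smul, smul_smul, Nat.cast_zero, zpow_zero, mul_one, Nat.cast_one, zpow_one, mul_assoc, mul_inv_cancel₀ hϖ0, mul_one]]
    exact finite_selfDualStable_smul_one_diag σ hϖ σO hσO' hσσ hσϖ le_rfl γ hγ ha hc hN ha₀ hq
  · -- `e = 1`: `S(ϖ^0 • 1, γ)`
    rw [show ϖ⁻¹ • ((ϖ ^ ((1 : ℕ) : ℤ)) • (1 : Matrix (Fin 2) (Fin 2) F)) = (ϖ ^ ((0 : ℕ) : ℤ)) • (1 : Matrix (Fin 2) (Fin 2) F) by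
      rw [smul_smul, Nat.cast_one, zpow_one, inv_mul_cancel₀ hϖ0, Nat.cast_zero, zpow_zero]]
    exact finite_selfDualStable_smul_one_diag σ hϖ σO hσO' hσσ hσϖ (Nat.zero_le 1) γ hγ ha hc hN ha₀ hq

include hϖ hσO' hσσ hσϖ he hγ ha hc hN in
/-- **EXACT DEPTH, ϖ-MODULAR (type `1 − e`) vertices**: `#{Λ ∈ M(ϖ^e • 1, γ) | (γ − c·1)Λ ≤ ϖ^iΛ ∧ ¬ (γ − c·1)Λ ≤ ϖ^{i+1}Λ} = [i ≤ N ∧ (N − i) % 2 = 1 − e]·w(N − i)`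
— finiteness + `Set.ncard_sdiff_add_ncard_of_subset` + ★ FILE 2 `ncard_modularStable_smul_one_diag_level_self_eq_sum`, `sum_filter_mod_two_add_le_eq`; the
`[N−i ≡ e+ε]·w(N−i)` coefficient of B-p12 (g29)'s unfolding display at `ε = 1`. [cite: Kottwitz1988, §2] [cite: Flicker1998UnitaryFL, §6 p. 95 REMARK] -/
theorem ncard_modularStable_smul_one_diag_depth_eq_ite [IsDiscreteValuationRing 𝒪[F]] [Finite (IsLocalRing.ResidueField 𝒪[F])]
    [IsAdicComplete (IsLocalRing.maximalIdeal 𝒪[F]) 𝒪[F]] {a₀ : 𝒪[F]} (ha₀ : IsUnit (σO a₀ - a₀)) {q : ℕ}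
    (hq : Nat.card (IsLocalRing.ResidueField 𝒪[F]) = q ^ 2) (i : ℕ) :
    {Λ : Submodule 𝒪[F] (Fin 2 → F) |
        ((∃ g : GL (Fin 2) F, (∃ J' ∈ glInt 2 F, ϖ • (J' : Matrix (Fin 2) (Fin 2) F) = formCongr σ g ((ϖ ^ (e : ℤ)) • (1 : Matrix (Fin 2) (Fin 2) F))) ∧
            Λ = Submodule.span 𝒪[F] (Set.range ((g : Matrix (Fin 2) (Fin 2) F))ᵀ)) ∧
          Λ.map ((Matrix.toLin' (γ : Matrix (Fin 2) (Fin 2) F)).restrictScalars 𝒪[F]) = Λ) ∧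
        (Λ.map ((Matrix.toLin' ((γ : Matrix (Fin 2) (Fin 2) F) - c • (1 : Matrix (Fin 2) (Fin 2) F))).restrictScalars 𝒪[F]) ≤
          Λ.map ((Matrix.toLin' (ϖ ^ i • (1 : Matrix (Fin 2) (Fin 2) F))).restrictScalars 𝒪[F]) ∧
        ¬ Λ.map ((Matrix.toLin' ((γ : Matrix (Fin 2) (Fin 2) F) - c • (1 : Matrix (Fin 2) (Fin 2) F))).restrictScalars 𝒪[F]) ≤
          Λ.map ((Matrix.toLin' (ϖ ^ (i + 1) • (1 : Matrix (Fin 2) (Fin 2) F))).restrictScalars 𝒪[F]))}.ncard =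
      if i ≤ N ∧ (N - i) % 2 = 1 - e then (if N - i = 0 then 1 else q ^ (N - i - 1) * (q + 1)) else 0 := by
  have hfin := finite_modularStable_smul_one_diag σ hϖ σO hσO' hσσ hσϖ he γ hγ ha hc hN ha₀ hq
  have hi := ncard_modularStable_smul_one_diag_level_self_eq_sum σ hϖ σO hσO' hσσ hσϖ he γ hγ ha hc hN ha₀ hq i
  have hi1 := ncard_modularStable_smul_one_diag_level_self_eq_sum σ hϖ σO hσO' hσσ hσϖ he γ hγ ha hc hN ha₀ hq (i + 1)
  rw [sum_filter_mod_two_add_le_eq _ N (1 - e) i] at hi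
  set Si := {Λ : Submodule 𝒪[F] (Fin 2 → F) |
        ((∃ g : GL (Fin 2) F, (∃ J' ∈ glInt 2 F, ϖ • (J' : Matrix (Fin 2) (Fin 2) F) = formCongr σ g ((ϖ ^ (e : ℤ)) • (1 : Matrix (Fin 2) (Fin 2) F))) ∧
            Λ = Submodule.span 𝒪[F] (Set.range ((g : Matrix (Fin 2) (Fin 2) F))ᵀ)) ∧
          Λ.map ((Matrix.toLin' (γ : Matrix (Fin 2) (Fin 2) F)).restrictScalars 𝒪[F]) = Λ) ∧
        Λ.map ((Matrix.toLin' ((γ : Matrix (Fin 2) (Fin 2) F) - c • (1 : Matrix (Fin 2) (Fin 2) F))).restrictScalars 𝒪[F]) ≤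
          Λ.map ((Matrix.toLin' (ϖ ^ i • (1 : Matrix (Fin 2) (Fin 2) F))).restrictScalars 𝒪[F])} with hSi
  set Si1 := {Λ : Submodule 𝒪[F] (Fin 2 → F) |
        ((∃ g : GL (Fin 2) F, (∃ J' ∈ glInt 2 F, ϖ • (J' : Matrix (Fin 2) (Fin 2) F) = formCongr σ g ((ϖ ^ (e : ℤ)) • (1 : Matrix (Fin 2) (Fin 2) F))) ∧
            Λ = Submodule.span 𝒪[F] (Set.range ((g : Matrix (Fin 2) (Fin 2) F))ᵀ)) ∧
          Λ.map ((Matrix.toLin' (γ : Matrix (Fin 2) (Fin 2) F)).restrictScalars 𝒪[F]) = Λ) ∧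
        Λ.map ((Matrix.toLin' ((γ : Matrix (Fin 2) (Fin 2) F) - c • (1 : Matrix (Fin 2) (Fin 2) F))).restrictScalars 𝒪[F]) ≤
          Λ.map ((Matrix.toLin' (ϖ ^ (i + 1) • (1 : Matrix (Fin 2) (Fin 2) F))).restrictScalars 𝒪[F])} with hSi1
  have hsub : Si1 ⊆ Si := fun Λ hΛ => ⟨hΛ.1, map_le_map_pow_smul_one_of_succ hϖ.mem i _ Λ hΛ.2⟩
  have hsplit := Set.ncard_sdiff_add_ncard_of_subset hsub (hfin.subset fun Λ hΛ => hΛ.1)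
  rw [hi, hi1] at hsplit
  have hdiff : {Λ : Submodule 𝒪[F] (Fin 2 → F) |
        ((∃ g : GL (Fin 2) F, (∃ J' ∈ glInt 2 F, ϖ • (J' : Matrix (Fin 2) (Fin 2) F) = formCongr σ g ((ϖ ^ (e : ℤ)) • (1 : Matrix (Fin 2) (Fin 2) F))) ∧
            Λ = Submodule.span 𝒪[F] (Set.range ((g : Matrix (Fin 2) (Fin 2) F))ᵀ)) ∧
          Λ.map ((Matrix.toLin' (γ : Matrix (Fin 2) (Fin 2) F)).restrictScalars 𝒪[F]) = Λ) ∧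
        (Λ.map ((Matrix.toLin' ((γ : Matrix (Fin 2) (Fin 2) F) - c • (1 : Matrix (Fin 2) (Fin 2) F))).restrictScalars 𝒪[F]) ≤
          Λ.map ((Matrix.toLin' (ϖ ^ i • (1 : Matrix (Fin 2) (Fin 2) F))).restrictScalars 𝒪[F]) ∧
        ¬ Λ.map ((Matrix.toLin' ((γ : Matrix (Fin 2) (Fin 2) F) - c • (1 : Matrix (Fin 2) (Fin 2) F))).restrictScalars 𝒪[F]) ≤
          Λ.map ((Matrix.toLin' (ϖ ^ (i + 1) • (1 : Matrix (Fin 2) (Fin 2) F))).restrictScalars 𝒪[F]))} = Si \ Si1 := by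
    ext Λ
    simp only [hSi, hSi1, Set.mem_setOf_eq, Set.mem_sdiff, not_and]
    exact ⟨fun h => ⟨⟨h.1, h.2.1⟩, fun _ => h.2.2⟩, fun h => ⟨h.1.1, h.1.2, h.2 h.1.1⟩⟩
  rw [hdiff]
  omega

end Modular

end Literature.NumberTheory.Automorphic

end
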